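import Summits.BirchSwinnertonDyer.Rank1Residual.GaloisImage.WildThreeAdicTowerTameTorsion
import Summits.BirchSwinnertonDyer.Rank1Residual.GaloisImage.NineTorsionOrbitSocket
import HarnessLib

/-!
# `v₃(j − 1728) = 3`: `9 ∣ #ρ̄₉(I₃)`, the ORBIT SOCKET of the EXOTIC core, and the Kato corollary
# of the tame-torsion tower
# (cell `b2b-bsdres`, team n1011, seat p02 gen 4 — row T-b11 'm = 3: structure of the wild inertia
# on E[9]' (p02 arm; p14's arm of the same row landed `WildThreeAdicTowerTameTorsion`, p269787),
# file F2a; sequel of T-b10 ARM A `WildThreeAdicTower` into its located gap `m = 3`)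

HONEST FRAMING (cell `b2b-bsdres`, run/shared/lean/b2b/bsd-rank1-residual/, verbatim in every
file): the goal of the cell is to DELETE the COMBINATION-SHAPED residual classes of the
Birch–Swinnerton-Dyer formula for ALL analytic-rank `≤ 1` elliptic curves over `ℚ` — "full BSD
formula for every rank `≤ 1` curve in class `C`" assembled STRICTLY from published theorems — so
that the rank-`≤ 1` remainder becomes exactly the CONSTRUCTION-SHAPED classes, which are TYPED
(missing-input `Prop`s), NOT attempted. This is not "finishing BSD". Team n1011 (N10 / N11):
research route; no claim beyond the stated classes; labels UNCHANGED; nothing is booked. Theorems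
only (no definition, no named fact).

## What this file proves

Let `E = W/ℚ` (any model) with `v₃(j − 1728) = 3` — Elkies' value, carried by every EXOTIC row of
X4 at `3` (`ClassX4.padicValRat_j_sub_eq_three_of_not_towerSurj_three`, p268581).  From p14's
`9`-socket `exists_mem_divisionField_nine_valuation_pow_9_of_eq_three` (a non-zero `w ∈ ℚ(E[9])`
with `v(w)⁹ · v(3)^a = v(3)^b`, `9` coprime to `a − b`; gen 3's ordinate valuation at `m = 3`):

* `nine_dvd_card_inertia_map_galoisRepTorsion_nine_of_padicValRat_j_sub_eq_three` (§1) —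
  **`9 ∣ #ρ̄_{E,9}(I_𝔓)`** for the inertia group of the place over `3`, no hypothesis on `ρ̄₃`
  (gen-2 socket `dvd_card_inertia_map_galoisRepTorsion_of_valuation`, p254468).  This is the
  standing hypothesis of the level-`9` dichotomy (F0 p266894, F1a p268240, F1b p269398): the
  `3`-Sylow of `ρ̄₉(I_𝔓)` has order `≥ 9` on the whole EXOTIC core.
* `towerSurj_three_of_surj_of_padicValRat_j_sub_eq_three_of_stable` (§2) — **the ORBIT SOCKET at
  `m = 3`**: `ρ̄_{E,3}` onto + a point `Q₀` of order `9` inside a finite `I_𝔓`-STABLE set of at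
  most `8` points of `E(ℚ̄)` ⟹ `ρ̄_{E,3ⁿ}` onto for every `n` (F1b with §1);
  `imageContainsSL2_three_of_surj_of_padicValRat_j_sub_eq_three_of_stable` (Kato (12.5.2));
  contrapositive `lt_ncard_of_inertia_stable_of_not_towerSurj_of_padicValRat_j_sub_eq_three` — on
  an EXOTIC row every finite inertia-stable set through a point of order `9` has `≥ 9` elements
  (the wild inertia on `E[9]` is the free `C₃ × C₃`).
* `imageContainsSL2_three_of_surj_of_padicValRat_j_sub_eq_three_of_not_three_dvd` and
  `three_dvd_card_inertia_map_three_of_not_towerSurj_of_padicValRat_j_sub_eq_three` (§3) — the Kato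
  (12.5.2) form and the EXOTIC contrapositive (`3 ∣ #ρ̄₃(I_𝔓)`: wild `E[3]`) of p14's tame-torsion
  tower p269787.

NUMERICS (EVIDENCE, `HOME/b2b-bsdres-n1011-p02/m3/M3-LOCAL-NOTE.md`, kit j131568 / j131572 /
j132091, 749 m = 3 cells = all 341 r0 EXOTIC-candidate cells + 20 Elkies + 388 controls): the
`3`-adic factorisation types of `ψ₉/ψ₃` and of the scalar-orbit trace polynomial certify "not the
free `C₃ × C₃`" on every cell with `v₃(N) = 3` or `v₃(j) ≤ 6` and on 321 of the 341 candidates; the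
locally undecided cells all have `v₃(N) = 5 ∧ v₃(j) ≥ 7` and, among the candidates, are EXACTLY the
20 Elkies curves — the same 321 + 20 split as p14's X₀(9) local witness (e11) and rmap-2's W9
Frobenius census (§D add. 16); every non-Elkies cell also carries a Frobenius element of order `9`
(F0's hypothesis) at a prime `ℓ ≤ 97`.  Nothing booked; no label change.

References: [SerreLocalFields1979] Ch. I §7; [SerreAbelianLadic1968] Ch. IV §3.4 Lemma 3 (IV-23);
[Elkies2006] arXiv:math/0612734; [Kato2004Asterisque] (12.5.2) p. 222.
-/

noncomputable section

open scoped Classical NumberField Pointwise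

open Field IsDedekindDomain WeierstrassCurve Rat.HeightOneSpectrum

namespace Summit.BirchSwinnertonDyer.Rank1Residual.GaloisImage

open Literature.NumberTheory.EllipticCurves Literature.NumberTheory.GaloisRepresentations

variable (W : WeierstrassCurve ℚ) [W.IsElliptic]

/-! ### §1 `9 ∣ #ρ̄₉(I_𝔓)` at `m = 3` -/

/-- **`v₃(j − 1728) = 3` ⟹ `9 ∣ #ρ̄_{E,9}(I_𝔓)`** for the inertia group `I_𝔓` of the place of `ℚ̄`
over `3` (any model of `E`, no hypothesis on `ρ̄₃`): p14's `9`-socket fed into the gen-2 counting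
socket. [cite: SerreLocalFields1979, Ch. I §7 Cor. to Prop. 21 and Prop. 22(b)] -/
theorem nine_dvd_card_inertia_map_galoisRepTorsion_nine_of_padicValRat_j_sub_eq_three
    (hj : padicValRat 3 (W.j - 1728) = 3)
    {v : HeightOneSpectrum (𝓞 ℚ)} (hv : (primesEquiv v : ℕ) = 3)
    {𝔓 : Ideal (absIntegers (𝓞 ℚ) ℚ)}
    (hmem : ∀ x : absIntegers (𝓞 ℚ) ℚ, x ∈ 𝔓 ↔ (x : AlgebraicClosure ℚ) ∈ (placeOver 3).nonunits)
    (h𝔓 : 𝔓 ∈ v.primesAbove) :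
    9 ∣ Nat.card ((𝔓.inertia (absoluteGaloisGroup ℚ)).map (galoisRepTorsion W 9)) := by
  haveI : NeZero (9 : ℕ) := ⟨by norm_num⟩
  obtain ⟨w, a, b, hwL, hw0, hval, hcop⟩ :=
    exists_mem_divisionField_nine_valuation_pow_9_of_eq_three W (by exact_mod_cast hj)
  have hd := dvd_card_inertia_map_galoisRepTorsion_of_valuation (W := W) (n := 9) hv hmem h𝔓 hwL
    hw0 hval hcop
  exact_mod_cast hd

/-! ### §2 The orbit socket at `m = 3` -/

/-- **ORBIT SOCKET AT `m = 3`.**  If `v₃(j − 1728) = 3`, `ρ̄_{E,3}` is onto, and some point `Q₀`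
of order `9` lies in a finite `I_𝔓`-stable set of at most `8` points of `E(ℚ̄)`, then `ρ̄_{E,3ⁿ}`
is onto for every `n` (§1 + F1b `towerSurj_three_of_surj_of_nine_dvd_card_of_stable`).
[cite: SerreAbelianLadic1968, Ch. IV §3.4, Lemma 3 (IV-23)] [cite: Elkies2006, §1] -/
theorem towerSurj_three_of_surj_of_padicValRat_j_sub_eq_three_of_stable
    (hj : padicValRat 3 (W.j - 1728) = 3) (hsurj : W.HasSurjectiveModNGaloisRep 3)
    {v : HeightOneSpectrum (𝓞 ℚ)} (hv : (primesEquiv v : ℕ) = 3)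
    {𝔓 : Ideal (absIntegers (𝓞 ℚ) ℚ)}
    (hmem : ∀ x : absIntegers (𝓞 ℚ) ℚ, x ∈ 𝔓 ↔ (x : AlgebraicClosure ℚ) ∈ (placeOver 3).nonunits)
    (h𝔓 : 𝔓 ∈ v.primesAbove) {Q₀ : W.geomPoints} (hQ₀9 : Q₀ ∈ geomTorsion W 9)
    (h3Q₀ : (3 : ℕ) • Q₀ ≠ 0) {S : Set W.geomPoints} (hSfin : S.Finite) (hS8 : S.ncard ≤ 8)
    (hQ₀S : Q₀ ∈ S) (hstab : ∀ σ ∈ 𝔓.inertia (absoluteGaloisGroup ℚ), ∀ X ∈ S, σ • X ∈ S) (n : ℕ) :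
    W.HasSurjectiveModNGaloisRep (3 ^ n : ℕ) :=
  towerSurj_three_of_surj_of_nine_dvd_card_of_stable W hsurj _
    (nine_dvd_card_inertia_map_galoisRepTorsion_nine_of_padicValRat_j_sub_eq_three W hj hv hmem h𝔓)
    hQ₀9 h3Q₀ hSfin hS8 hQ₀S hstab n

/-- **Kato's (12.5.2) at `3`** from `v₃(j − 1728) = 3`, surj(3) and a small inertia-stable set
through a point of order nine. [cite: Kato2004Asterisque, (12.5.2) (p. 222)] [cite: SerreAbelianLadic1968, Ch. IV §3.4, Lemma 3 (IV-23)] -/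
theorem imageContainsSL2_three_of_surj_of_padicValRat_j_sub_eq_three_of_stable
    (hj : padicValRat 3 (W.j - 1728) = 3) (hsurj : W.HasSurjectiveModNGaloisRep 3)
    {v : HeightOneSpectrum (𝓞 ℚ)} (hv : (primesEquiv v : ℕ) = 3)
    {𝔓 : Ideal (absIntegers (𝓞 ℚ) ℚ)}
    (hmem : ∀ x : absIntegers (𝓞 ℚ) ℚ, x ∈ 𝔓 ↔ (x : AlgebraicClosure ℚ) ∈ (placeOver 3).nonunits)
    (h𝔓 : 𝔓 ∈ v.primesAbove) {Q₀ : W.geomPoints} (hQ₀9 : Q₀ ∈ geomTorsion W 9)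
    (h3Q₀ : (3 : ℕ) • Q₀ ≠ 0) {S : Set W.geomPoints} (hSfin : S.Finite) (hS8 : S.ncard ≤ 8)
    (hQ₀S : Q₀ ∈ S) (hstab : ∀ σ ∈ 𝔓.inertia (absoluteGaloisGroup ℚ), ∀ X ∈ S, σ • X ∈ S) :
    Kato2004.ImageContainsSL2 W 3 := by
  haveI : Fact (Nat.Prime 3) := ⟨Nat.prime_three⟩
  exact (Kato2004.imageContainsSL2_iff_forall_hasSurjectiveModNGaloisRep W 3).mpr
    (towerSurj_three_of_surj_of_padicValRat_j_sub_eq_three_of_stable W hj hsurj hv hmem h𝔓 hQ₀9 h3Q₀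
      hSfin hS8 hQ₀S hstab)

/-- **On an EXOTIC row inertia-stable sets through points of order nine are large**: if
`v₃(j − 1728) = 3`, `ρ̄_{E,3}` is onto and the tower fails at some level, every finite `I_𝔓`-stable
set containing a point of order `9` has at least `9` elements. [cite: Elkies2006, §1–§2] -/
theorem lt_ncard_of_inertia_stable_of_not_towerSurj_of_padicValRat_j_sub_eq_three
    (hj : padicValRat 3 (W.j - 1728) = 3) (hsurj : W.HasSurjectiveModNGaloisRep 3)
    (hnot : ¬ ∀ n : ℕ, W.HasSurjectiveModNGaloisRep (3 ^ n : ℕ))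
    {v : HeightOneSpectrum (𝓞 ℚ)} (hv : (primesEquiv v : ℕ) = 3)
    {𝔓 : Ideal (absIntegers (𝓞 ℚ) ℚ)}
    (hmem : ∀ x : absIntegers (𝓞 ℚ) ℚ, x ∈ 𝔓 ↔ (x : AlgebraicClosure ℚ) ∈ (placeOver 3).nonunits)
    (h𝔓 : 𝔓 ∈ v.primesAbove) {Q₀ : W.geomPoints} (hQ₀9 : Q₀ ∈ geomTorsion W 9)
    (h3Q₀ : (3 : ℕ) • Q₀ ≠ 0) {S : Set W.geomPoints} (hSfin : S.Finite) (hQ₀S : Q₀ ∈ S)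
    (hstab : ∀ σ ∈ 𝔓.inertia (absoluteGaloisGroup ℚ), ∀ X ∈ S, σ • X ∈ S) : 8 < S.ncard :=
  lt_ncard_of_stable_of_surj_of_not_towerSurj W hsurj hnot _
    (nine_dvd_card_inertia_map_galoisRepTorsion_nine_of_padicValRat_j_sub_eq_three W hj hv hmem h𝔓)
    hQ₀9 h3Q₀ hSfin hQ₀S hstab

/-! ### §3 Kato (12.5.2) and the EXOTIC contrapositive of the tame-torsion tower -/

/-- **Kato's (12.5.2) at `3`** from `v₃(j − 1728) = 3`, surj(3) and tameness of `ρ̄₃` on inertia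
(p14's `towerSurj_three_of_surj_of_padicValRat_j_sub_eq_three_of_not_three_dvd`).
[cite: Kato2004Asterisque, (12.5.2) (p. 222)] [cite: SerreAbelianLadic1968, Ch. IV §3.4, Lemma 3 (IV-23)] -/
theorem imageContainsSL2_three_of_surj_of_padicValRat_j_sub_eq_three_of_not_three_dvd
    (hj : padicValRat 3 (W.j - 1728) = 3) (hsurj : W.HasSurjectiveModNGaloisRep 3)
    {v : HeightOneSpectrum (𝓞 ℚ)} (hv : (primesEquiv v : ℕ) = 3)
    {𝔓 : Ideal (absIntegers (𝓞 ℚ) ℚ)}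
    (hmem : ∀ x : absIntegers (𝓞 ℚ) ℚ, x ∈ 𝔓 ↔ (x : AlgebraicClosure ℚ) ∈ (placeOver 3).nonunits)
    (h𝔓 : 𝔓 ∈ v.primesAbove)
    (h3 : ¬ 3 ∣ Nat.card ((𝔓.inertia (absoluteGaloisGroup ℚ)).map (galoisRepTorsion W 3))) :
    Kato2004.ImageContainsSL2 W 3 := by
  haveI : Fact (Nat.Prime 3) := ⟨Nat.prime_three⟩
  exact (Kato2004.imageContainsSL2_iff_forall_hasSurjectiveModNGaloisRep W 3).mpr
    (towerSurj_three_of_surj_of_padicValRat_j_sub_eq_three_of_not_three_dvd W (by exact_mod_cast hj)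
      hsurj hv hmem h𝔓 h3)

/-- **On an EXOTIC row with `v₃(j − 1728) = 3` the wild inertia acts non-trivially on `E[3]`**:
if `ρ̄_{E,3}` is onto and the tower fails at some level, then `3 ∣ #ρ̄_{E,3}(I_𝔓)`.
[cite: Elkies2006, §4] -/
theorem three_dvd_card_inertia_map_three_of_not_towerSurj_of_padicValRat_j_sub_eq_three
    (hj : padicValRat 3 (W.j - 1728) = 3) (hsurj : W.HasSurjectiveModNGaloisRep 3)
    (hnot : ¬ ∀ n : ℕ, W.HasSurjectiveModNGaloisRep (3 ^ n : ℕ))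
    {v : HeightOneSpectrum (𝓞 ℚ)} (hv : (primesEquiv v : ℕ) = 3)
    {𝔓 : Ideal (absIntegers (𝓞 ℚ) ℚ)}
    (hmem : ∀ x : absIntegers (𝓞 ℚ) ℚ, x ∈ 𝔓 ↔ (x : AlgebraicClosure ℚ) ∈ (placeOver 3).nonunits)
    (h𝔓 : 𝔓 ∈ v.primesAbove) :
    3 ∣ Nat.card ((𝔓.inertia (absoluteGaloisGroup ℚ)).map (galoisRepTorsion W 3)) := by
  by_contra h3
  exact hnot (towerSurj_three_of_surj_of_padicValRat_j_sub_eq_three_of_not_three_dvd W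
    (by exact_mod_cast hj) hsurj hv hmem h𝔓 h3)

end Summit.BirchSwinnertonDyer.Rank1Residual.GaloisImage

end
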